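import Summits.ValiantsHypothesis.ValiantsHypothesis.Theses.MonotoneRestoration
import Summits.ValiantsHypothesis.ValiantsHypothesis.Theorems.CirculantFourierHrubesBridge
import Summits.ValiantsHypothesis.ValiantsHypothesis.Theorems.CirculantFourierRealFormsRealify

/-!
# Route `MonotoneRestoration`, support item `SensitiveBridge` (stmt-ValiantsHypothesis-15888)

Closes `Summit.ValiantsHypothesis.ValiantsHypothesis.Theses.MonotoneRestoration.SensitiveBridge`:
for every matrix-symmetric family `h_n ∈ ℝ≥0[x_ij : i, j < n]` whose complexification is a `VP`
family there are `c` and, for every `n`, a degree `d ≤ (n+2)^c`, an `ε > 0` and `g ∈ ℝ≥0[x_ij]`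
with `map g = (1 + Σ_ij x_ij)^d + ε · map h_n`, `totalDegree g ≤ (n+2)^c`, `g` invariant under
independent row and column permutations, and monotone circuit complexity (the tree's `complexity`
over the semiring `ℝ≥0`) at most `(n+2)^c`.

Proof (glue over proved tree theorems; Hrubeš 2020, *On ε-sensitive monotone computations*,
Thm. 1, in the form proved in `Theorems/CirculantFourierHrubesBridge*`):

* realification (`Theorems/CirculantFourierRealFormsRealify`): the real form
  `f = map toRealHom h_n` has `L_ℝ(f) ≤ 6 · L_ℂ(map h_n)` (`exists_realPart_complexity_le`,
  `map_ofRealHom_eq_of_im_eq_zero`, injectivity of `map ofRealHom`), and the same total degree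
  `d` as its complexification;
* Hrubeš's one-pass simulation run DIRECTLY over the variable type `Fin n × Fin n` (the lemmas
  `rep_gates`, `rep_operand`, `final_poly`, `size_arith` of the `CirculantFourierHrubes` files are
  stated for an arbitrary finite variable type, so no transport `Fin (n·n) ≃ Fin n × Fin n` is
  needed): with `ε := (1 + Σ_k c_k)⁻¹` it yields `g` over `ℝ≥0` and a plain fan-in-two monotone
  circuit `R` computing `g` with `|R| ≤ 32 (L_ℝ(f) + n² + d + 1)³`, whence
  `complexity g ≤ |R|` (`complexity_le_size`);
* invariance of `g` under `x_ij ↦ x_{σ i, τ j}`: `map toRealHom` is injective and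
  `(1 + Σ x)^d + ε f` is invariant (the sum of all variables is, and `f` is by hypothesis);
* arithmetic: with `deg ≤ n^{c₁} + c₁`, `L_ℂ ≤ n^{c₂} + c₂` everything is `≤ (n+2)^{3(c₁+c₂)+23}`.
-/

noncomputable section

-- `Summit.ValiantsHypothesis.ValiantsHypothesis.…` is the tree's mandated layout (Sub = Summit).
set_option linter.dupNamespace false

namespace Summit.ValiantsHypothesis.ValiantsHypothesis.Theorems.MonotoneRestorationSensitive

open MvPolynomial Literature.Computability.AlgebraicComplexity ArithCircuit
  Literature.Barriers.ValiantsHypothesis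
  Summit.ValiantsHypothesis.ValiantsHypothesis.Theorems.CirculantFourierHrubes
  Summit.ValiantsHypothesis.ValiantsHypothesis.Theorems.RealForms
open scoped NNReal

/-- The total degree is invariant under an injective change of coefficients (the support is
unchanged, `MvPolynomial.support_map_of_injective`). -/
theorem totalDegree_map_of_injective {R S τ : Type*} [CommSemiring R] [CommSemiring S]
    {φ : R →+* S} (hφ : Function.Injective φ) (p : MvPolynomial τ R) :
    (map φ p).totalDegree = p.totalDegree := by
  simp only [totalDegree, support_map_of_injective p hφ]

/-- Realification of complexity for nonnegative polynomials: the real form `map toRealHom q` of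
`q ∈ ℝ≥0[X]` has real circuit complexity at most `6 ·` the complex circuit complexity of its
complexification (`exists_realPart_complexity_le`: the coefficientwise real part of a complex
polynomial `F` costs `≤ 6 L_ℂ(F)`; here `F = map q` has real coefficients, so its real part is the
real form itself). -/
theorem complexity_real_le {τ : Type*} (q : MvPolynomial τ ℝ≥0) :
    complexity (map NNReal.toRealHom q) ≤
      6 * complexity (map (Complex.ofRealHom.comp NNReal.toRealHom) q) := by
  obtain ⟨x, y, hF, hx⟩ :=
    exists_realPart_complexity_le (map (Complex.ofRealHom.comp NNReal.toRealHom) q)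
  have him : ∀ m, (coeff m (map (Complex.ofRealHom.comp NNReal.toRealHom) q)).im = 0 := by
    intro m
    simp only [coeff_map, RingHom.coe_comp, Function.comp_apply, Complex.ofRealHom_eq_coe,
      Complex.ofReal_im]
  have hxF := map_ofRealHom_eq_of_im_eq_zero hF him
  have hxq : x = map NNReal.toRealHom q := by
    apply map_injective Complex.ofRealHom Complex.ofRealHom.injective
    rw [hxF, map_map]
  rw [← hxq]
  exact hx

/-- The arithmetic of the exponent: if `D ≤ n^{c₁} + c₁` and `L ≤ 6 (n^{c₂} + c₂)` then both
`L + n² + D + 1` and `32 (L + n² + D + 1)³` are at most `(n+2)^{3(c₁+c₂)+23}`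
(everything is `≤ 16 M` with `M = (n+2)^{c₁+c₂+2}`, and `32 · 16³ = 2^17 ≤ (n+2)^17`). -/
theorem size_exponent (n c₁ c₂ D L : ℕ) (hD : D ≤ n ^ c₁ + c₁) (hL : L ≤ 6 * (n ^ c₂ + c₂)) :
    L + n * n + D + 1 ≤ (n + 2) ^ (3 * (c₁ + c₂) + 23) ∧
      32 * (L + n * n + D + 1) ^ 3 ≤ (n + 2) ^ (3 * (c₁ + c₂) + 23) := by
  obtain ⟨M, hM⟩ : ∃ M : ℕ, (n + 2) ^ (c₁ + c₂ + 2) = M := ⟨_, rfl⟩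
  have hpow : ∀ {a b : ℕ}, a ≤ b → (n + 2) ^ a ≤ (n + 2) ^ b := fun hab =>
    Nat.pow_le_pow_right (by omega) hab
  have hn1 : n ^ c₁ ≤ M := by
    rw [← hM]; exact (Nat.pow_le_pow_left (by omega) c₁).trans (hpow (by omega))
  have hn2 : n ^ c₂ ≤ M := by
    rw [← hM]; exact (Nat.pow_le_pow_left (by omega) c₂).trans (hpow (by omega))
  have hc1 : c₁ ≤ M := by
    rw [← hM]
    exact ((Nat.lt_two_pow_self (n := c₁)).le.trans (Nat.pow_le_pow_left (by omega) c₁)).trans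
      (hpow (by omega))
  have hc2 : c₂ ≤ M := by
    rw [← hM]
    exact ((Nat.lt_two_pow_self (n := c₂)).le.trans (Nat.pow_le_pow_left (by omega) c₂)).trans
      (hpow (by omega))
  have hnn : n * n ≤ M := by
    rw [← hM]
    calc n * n ≤ (n + 2) ^ 2 := by rw [pow_two]; exact Nat.mul_le_mul (by omega) (by omega)
      _ ≤ (n + 2) ^ (c₁ + c₂ + 2) := hpow (by omega)
  have h1 : 1 ≤ M := by rw [← hM]; exact Nat.one_le_pow _ _ (by omega)
  have hx : L + n * n + D + 1 ≤ 16 * M := by linarith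
  have hmain : 32 * (L + n * n + D + 1) ^ 3 ≤ (n + 2) ^ (3 * (c₁ + c₂) + 23) :=
    calc 32 * (L + n * n + D + 1) ^ 3 ≤ 32 * (16 * M) ^ 3 :=
          Nat.mul_le_mul_left _ (Nat.pow_le_pow_left hx 3)
      _ = 2 ^ 17 * M ^ 3 := by ring
      _ ≤ (n + 2) ^ 17 * M ^ 3 := Nat.mul_le_mul_right _ (Nat.pow_le_pow_left (by omega) 17)
      _ = (n + 2) ^ (3 * (c₁ + c₂) + 23) := by
          rw [← hM, ← pow_mul, ← pow_add]
          congr 1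
          ring
  refine ⟨?_, hmain⟩
  calc L + n * n + D + 1 ≤ (L + n * n + D + 1) ^ 3 := Nat.le_self_pow (by norm_num) _
    _ ≤ 32 * (L + n * n + D + 1) ^ 3 := Nat.le_mul_of_pos_left _ (by norm_num)
    _ ≤ _ := hmain

/-- **Hrubeš's bridge for nonnegative families** (item `SensitiveBridge` of route
`MonotoneRestoration`, stmt-ValiantsHypothesis-15888): for every matrix-symmetric family
`h_n ∈ ℝ≥0[x_ij]` whose complexification is a `VP` family there is `c` such that for every `n`
there are `d ≤ (n+2)^c`, `ε > 0` and `g ∈ ℝ≥0[x_ij]` with `map g = (1 + Σ_ij x_ij)^d + ε · map h_n`,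
`totalDegree g ≤ (n+2)^c`, `g` invariant under independent row/column permutations and
`complexity g ≤ (n+2)^c` over the semiring `ℝ≥0`. Hrubeš 2020, Thm. 1, through the generic-variable
simulation lemmas of `Theorems/CirculantFourierHrubesBridge*` (run over `Fin n × Fin n`), the
realification lemmas of `Theorems/CirculantFourierRealFormsRealify`, and `complexity_le_size`. -/
theorem sensitiveBridge_proof :
    Summit.ValiantsHypothesis.ValiantsHypothesis.Theses.MonotoneRestoration.SensitiveBridge := by
  intro h hsymm hVP
  obtain ⟨⟨-, c₁, hc₁⟩, c₂, hc₂⟩ := hVP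
  refine ⟨3 * (c₁ + c₂) + 23, fun n => ?_⟩
  -- the real form `f` of `h n`, its degree `d`, its complexity
  obtain ⟨f, hfdef⟩ : ∃ f : MvPolynomial (Fin n × Fin n) ℝ, f = map NNReal.toRealHom (h n) :=
    ⟨_, rfl⟩
  obtain ⟨d, hddef⟩ : ∃ d : ℕ, d = f.totalDegree := ⟨_, rfl⟩
  have hinj : Function.Injective (NNReal.toRealHom : ℝ≥0 →+* ℝ) := by
    rw [NNReal.coe_toRealHom]; exact NNReal.coe_injective
  have hφ : map (Complex.ofRealHom.comp NNReal.toRealHom) (h n) = map Complex.ofRealHom f := by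
    rw [hfdef, map_map]
  have hdeg : d ≤ n ^ c₁ + c₁ := by
    have h1 : (map (Complex.ofRealHom.comp NNReal.toRealHom) (h n)).totalDegree ≤ n ^ c₁ + c₁ :=
      hc₁ n
    rwa [hφ, totalDegree_map_of_injective Complex.ofRealHom.injective, ← hddef] at h1
  have hcplx : complexity f ≤ 6 * (n ^ c₂ + c₂) := by
    have h1 : complexity (map (Complex.ofRealHom.comp NNReal.toRealHom) (h n)) ≤ n ^ c₂ + c₂ :=
      hc₂ n
    rw [hfdef]
    exact (complexity_real_le (h n)).trans (Nat.mul_le_mul_left 6 h1)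
  obtain ⟨hxK, hK⟩ := size_exponent n c₁ c₂ d (complexity f) hdeg hcplx
  have hdK : d ≤ (n + 2) ^ (3 * (c₁ + c₂) + 23) := le_trans (by omega) hxK
  -- Hrubeš: simulate a size-optimal real fan-in-two circuit for `f` by plain monotone gates
  obtain ⟨P₀, hfan, hcomp, hsize⟩ := ArithCircuit.exists_computes_size_eq_complexity f
  obtain ⟨gs, hgs, hlen, hrep⟩ := rep_gates d P₀.gates hfan
  obtain ⟨gs₁, hg₁, hl₁, hrf⟩ := rep_operand hgs d (gateValues P₀.gates) hrep P₀.output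
  have hcomp' : P₀.output.eval (gateValues P₀.gates) = f := hcomp
  rw [hcomp'] at hrf
  obtain ⟨P, Q, c, hPQ⟩ := hrf
  -- the choice of `ε`
  have hS : 0 ≤ ∑ k ∈ Finset.range (d + 1), (c k : ℝ) :=
    Finset.sum_nonneg fun k _ => (c k).coe_nonneg
  obtain ⟨ε, hε, hεS⟩ : ∃ ε : ℝ, 0 < ε ∧ ε * (1 + ∑ k ∈ Finset.range (d + 1), (c k : ℝ)) ≤ 1 :=
    ⟨(1 + ∑ k ∈ Finset.range (d + 1), (c k : ℝ))⁻¹, inv_pos.mpr (by linarith),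
      (inv_mul_cancel₀ (by linarith : (1 + ∑ k ∈ Finset.range (d + 1), (c k : ℝ)) ≠ 0)).le⟩
  have hεc : ∀ k ≤ d, ε * (c k : ℝ) ≤ 1 := by
    intro k hk
    have hck : (c k : ℝ) ≤ ∑ k ∈ Finset.range (d + 1), (c k : ℝ) :=
      Finset.single_le_sum (f := fun k => (c k : ℝ)) (fun k _ => (c k).coe_nonneg)
        (Finset.mem_range.mpr (by omega))
    have h1 : ε * (c k : ℝ) ≤ ε * (1 + ∑ k ∈ Finset.range (d + 1), (c k : ℝ)) :=
      mul_le_mul_of_nonneg_left (by linarith) hε.le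
    linarith
  obtain ⟨g, R, hg, hR, hRsize⟩ := final_poly hg₁ hddef.ge P Q c hPQ hε hεc
  obtain ⟨hR₁, -, hR₃⟩ := hR
  -- the size of the monotone circuit
  have hRsize' : R.size ≤ 32 * (complexity f + n * n + d + 1) ^ 3 := by
    have hcard : Fintype.card (Fin n × Fin n) = n * n := by simp
    have hgl : P₀.gates.length = complexity f := hsize
    rw [List.length_append, hcard] at hRsize
    rw [hcard, hgl] at hlen
    rw [hcard] at hl₁
    calc R.size ≤ gs.length + gs₁.length + (n * n + 3 * (d + 1) + d + 2) := hRsize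
      _ ≤ complexity f * (2 * (n * n + 2 + 8 * (d + 1) ^ 2)) + (n * n + 2) +
            (n * n + 3 * (d + 1) + d + 2) :=
          Nat.add_le_add_right (Nat.add_le_add hlen hl₁) _
      _ ≤ 32 * (complexity f + n * n + d + 1) ^ 3 := size_arith _ _ _
  refine ⟨d, ε, hε, hdK, g, ?_, ?_, ?_, ?_⟩
  · -- the identity over `ℂ`
    rw [← map_map NNReal.toRealHom Complex.ofRealHom g, hg, hφ]
    simp only [map_add, map_pow, map_one, map_sum, map_X, map_mul, map_C,
      Complex.ofRealHom_eq_coe]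
  · -- the degree of `g`
    refine le_trans ?_ hdK
    rw [← totalDegree_map_of_injective hinj g, hg]
    refine (totalDegree_add _ _).trans (max_le ?_ ?_)
    · refine (totalDegree_pow _ _).trans ?_
      have h1 : (1 + ∑ i : Fin n × Fin n, (X i : MvPolynomial (Fin n × Fin n) ℝ)).totalDegree ≤
          1 :=
        (totalDegree_add _ _).trans (max_le (totalDegree_one.trans_le (Nat.zero_le 1))
          (totalDegree_finsetSum_le fun i _ => (totalDegree_X (R := ℝ) i).le))
      calc d * (1 + ∑ i : Fin n × Fin n, (X i : MvPolynomial (Fin n × Fin n) ℝ)).totalDegree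
          ≤ d * 1 := Nat.mul_le_mul_left d h1
        _ = d := mul_one d
    · calc (C ε * f).totalDegree ≤ (C ε).totalDegree + f.totalDegree := totalDegree_mul _ _
        _ = d := by rw [totalDegree_C, zero_add, hddef]
  · -- invariance under independent row and column permutations
    intro σ' τ'
    have hsumX : (∑ x : Fin n × Fin n, (X (σ' x.1, τ' x.2) : MvPolynomial (Fin n × Fin n) ℝ)) =
        ∑ i, X i :=
      Fintype.sum_equiv (Equiv.prodCongr σ' τ') _ _ fun p => by rcases p with ⟨a, b⟩; rfl
    apply map_injective NNReal.toRealHom hinj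
    rw [map_rename, hg]
    simp only [map_add, map_pow, map_one, map_mul, rename_C, map_sum, rename_X]
    rw [hsumX, hfdef, ← map_rename, hsymm n σ' τ']
  · -- the monotone complexity of `g`
    calc complexity g ≤ R.size := complexity_le_size hR₁ hR₃
      _ ≤ 32 * (complexity f + n * n + d + 1) ^ 3 := hRsize'
      _ ≤ (n + 2) ^ (3 * (c₁ + c₂) + 23) := hK

end Summit.ValiantsHypothesis.ValiantsHypothesis.Theorems.MonotoneRestorationSensitive

end
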